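import Mathlib
import HarnessLib
import Summits.ResolutionOfSingularities.ResolutionOfSingularities.Theorems.WildQuotientsWildQuotientResolutionS1aKillCentreRule
import Summits.ResolutionOfSingularities.ResolutionOfSingularities.Theorems.WildQuotientsWildQuotientResolutionS1aFrameWins

/-!
# S1a — `WinningStrategy p` FROM THE KILL-CENTRE RULE (the `Theses`-cone wrapper of `…S1aKillCentreRule`)

[OURS · L1 W4.5c · lead-1 g7] — NOT statements of the manuscript; counted 0; AI-level work, weaker than expert review.
Crux stmt-ResolutionOfSingularities-17941, line `s1a-logminvertex` v6, registered stub `stub_winningStrategy`.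

* **`winningStrategy_of_killCentreRule`** — `KillCentreRule p → S1.FrameWins.WinningStrategy p` (`p` prime): the registered stub is
  CLOSED MODULO the one OURS statement `KillCentreRule p` (`GameFrame.GModel.wins_initial_of_killCentreRule`).
* `cyclicQuotientFourfolds_of_door_of_killCentreRule`, `…_of_berghRydh_of_killCentreRule` — door + rule ⇒ the sub-crux.
-/

set_option linter.dupNamespace false

noncomputable section

open CategoryTheory Limits AlgebraicGeometry TopologicalSpace
open Literature.AlgebraicGeometry.Resolution Literature.AlgebraicGeometry.RelativeSpec
open Summit.ResolutionOfSingularities.ResolutionOfSingularities.Theorems.WildQuotientResolution.S1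
open Summit.ResolutionOfSingularities.ResolutionOfSingularities.Theorems.WildQuotientResolution.S1.NodeAtlas
open Summit.ResolutionOfSingularities.ResolutionOfSingularities.Theorems.WildQuotientResolution.S1.GameFrame

namespace Summit.ResolutionOfSingularities.ResolutionOfSingularities.Theorems.WildQuotientResolution.S1

/-- **THE TERMINATION CRUX REDUCED TO THE KILL-CENTRE RULE**: `KillCentreRule p → WinningStrategy p`. [OURS · L1 W4.5c] -/
theorem winningStrategy_of_killCentreRule {p : ℕ} (hp : p.Prime) (hrule : KillCentreRule p) : FrameWins.WinningStrategy p := by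
  intro k _ _ _ X' X₁ f q G _ _ ρ _ _ hfft hfqc _ _ _ hqfin _ _ hq _ _ _ g₀ hg₀ _ h₀
  haveI := hfft
  haveI := hfqc
  haveI := hqfin
  exact GModel.wins_initial_of_killCentreRule hp hrule f hg₀ hq h₀

/-- **Door + kill-centre rule ⇒ the sub-crux `CyclicQuotientFourfolds`** (with the frame `…S1aFrameWins`). [OURS · L1 W4.5c] -/
theorem cyclicQuotientFourfolds_of_door_of_killCentreRule (hD : FrameWins.DoorStatement)
    (hrule : ∀ p : ℕ, p.Prime → KillCentreRule p) :
    Summit.ResolutionOfSingularities.ResolutionOfSingularities.Theses.WildQuotients.CyclicQuotientFourfolds :=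
  FrameWins.cyclicQuotientFourfolds_of_door_of_wins hD fun p hp _ => winningStrategy_of_killCentreRule hp (hrule p hp)

/-- **Modulo Bergh–Rydh (named fact) and the kill-centre rule, the sub-crux holds.** [OURS · L1 W4.5c] -/
theorem cyclicQuotientFourfolds_of_berghRydh_of_killCentreRule (hBR : BerghRydh2019_diagonalizableQuotientResolution)
    (hrule : ∀ p : ℕ, p.Prime → KillCentreRule p) :
    Summit.ResolutionOfSingularities.ResolutionOfSingularities.Theses.WildQuotients.CyclicQuotientFourfolds :=
  FrameWins.cyclicQuotientFourfolds_of_berghRydh_of_wins hBR fun p hp _ => winningStrategy_of_killCentreRule hp (hrule p hp)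

end Summit.ResolutionOfSingularities.ResolutionOfSingularities.Theorems.WildQuotientResolution.S1

end
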